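import Literature.NumberTheory.GaloisCohomology.RestrictedRamificationEulerCharacteristicSES
import Literature.NumberTheory.GaloisRepresentations.PPrimaryDevissage
import Mathlib.GroupTheory.Torsion
import HarnessLib

/-!
# Tate's identity for `p`-PRIMARY coefficients follows from the case of coefficients KILLED BY `p`
# (Milne ADT I §5, proof of Thm. 5.1: "it suffices to prove the theorem for `M` killed by `p`")

Topic `NumberTheory/GaloisCohomology`; namespace `Literature.NumberTheory.GaloisCohomology`.
THEOREMS ONLY (no definition, no named fact, no `sorry`, no instance; D-0026).  Lane «TATE-EPC-TC» of
cell `bsd-eis` (crux `GoodLatticeBDPValue`, stmt-BirchSwinnertonDyer-19032), brick (B9b-α): the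
first dévissage of the assembly (brick B9), as a stand-alone lemma in the currency of the lane's
per-prime statement `EPC_TC_p K p` (`restrictedCohomology` of a discrete `Γ_K`-module, exponent
`e`, `e = nrComplexPlaces K` in `EPC_TC_p`).

Milne, *Arithmetic Duality Theorems*, I §5 (proof of Thm. 5.1, p. 69), after Lemma 5.3 ("`φ` is
multiplicative"): the theorem for a finite `G_S`-module `M` of `p`-power order follows from the case
`pM = 0` by induction on `#M` through `0 → M[p] → M → M/M[p] → 0`.  At a totally complex `K` with
`S ⊇ S_p` finite, multiplicativity is the tree's `restrictedCohomology_euler_X₂`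
(`RestrictedRamificationEulerCharacteristicSES.lean`; `H³(G_S, M[p]) = 0` by `cd_p G_S ≤ 2`), which
needs NO finiteness of the `H²` (the identities force it).

* **`restrictedCohomology_euler_of_forall_killedBy`** — `K` totally complex, `S ⊇ S_p` finite,
  `e : ℕ`: if `#H⁰(G_S, B)·#H²(G_S, B)·#B^e = #H¹(G_S, B)` for every finite discrete `Γ_K`-module
  `B` unramified outside `S` and killed by `p` (`∀ b, (p : ℤ) • b = 0`, the hypothesis shape of the
  finite-group bricks), then the same identity holds for every finite discrete `p`-PRIMARY `M`
  unramified outside `S`.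
* **`eulerTC_of_eulerTC_killedBy`** — the `∀`-packaged form: `EPC_TC_p K p` (token shape of the
  bus, 2026-08-29T00:36:43Z) follows from its restriction to modules killed by `p`.

## References
* J. S. Milne, *Arithmetic Duality Theorems*, 2nd ed. (2006), I §5, proof of Thm. 5.1 (p. 69),
  Lemma 5.3. [MilneADT2006]
* J. Neukirch, A. Schmidt, K. Wingberg, *Cohomology of Number Fields*, 2nd ed. (2008), (8.3.18),
  (8.7.4). [NeukirchSchmidtWingberg2008]
-/

noncomputable section

open CategoryTheory Function NumberField Field IsDedekindDomain
open scoped NumberField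

namespace Literature.NumberTheory.GaloisCohomology

open Literature.NumberTheory.GaloisRepresentations
open Literature.NumberTheory.GaloisRepresentations.DiscreteGaloisModule (restrictedCohomology)
open _root_.TopRep _root_.ContRepresentation _root_.ContinuousCohomology

variable {K : Type} [Field K] [NumberField K] [IsTotallyComplex K] {S : Set (HeightOneSpectrum (𝓞 K))}

/-- **`p`-primary from killed-by-`p`** (Milne I §5, proof of Thm. 5.1: "it suffices to prove the
theorem for `M` killed by `p`").  `K` totally complex, `S ⊇ S_p` finite, `e : ℕ`.  If Tate's identity
`#H⁰(G_S, B)·#H²(G_S, B)·#B^e = #H¹(G_S, B)` holds for every finite discrete `Γ_K`-module `B`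
unramified outside `S` with `(p : ℤ) • B = 0`, it holds for every finite discrete `p`-primary `M`
unramified outside `S` — induction on `#M` along `0 → M[p] → M → M/M[p] → 0`
(`restrictedCohomology_euler_X₂`). [cite: MilneADT2006, I §5, proof of Thm. 5.1 (p. 69)]
[cite: NeukirchSchmidtWingberg2008, (8.3.18)] -/
theorem restrictedCohomology_euler_of_forall_killedBy (hSfin : S.Finite) (p : ℕ) [hp : Fact p.Prime]
    (hSp : ∀ v : HeightOneSpectrum (𝓞 K), ((p : ℕ) : 𝓞 K) ∈ v.asIdeal → v ∈ S) (e : ℕ)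
    (hkill : ∀ (B : Type) [AddCommGroup B] [TopologicalSpace B] [DiscreteTopology B] [Finite B]
      (σ : DiscreteGaloisModule K B), GaloisRep.IsUnramifiedOutside S σ → (∀ b : B, (p : ℤ) • b = 0) →
      Nat.card (restrictedCohomology σ S 0) * Nat.card (restrictedCohomology σ S 2) * Nat.card B ^ e =
        Nat.card (restrictedCohomology σ S 1))
    (M : Type) [AddCommGroup M] [TopologicalSpace M] [DiscreteTopology M] [Finite M]
    (ρ : DiscreteGaloisModule K M) (hur : GaloisRep.IsUnramifiedOutside S ρ) (hM : IsPrimaryTorsion p M) :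
    Nat.card (restrictedCohomology ρ S 0) * Nat.card (restrictedCohomology ρ S 2) * Nat.card M ^ e =
      Nat.card (restrictedCohomology ρ S 1) := by
  classical
  suffices key : ∀ (n : ℕ) (M : Type) [AddCommGroup M] [TopologicalSpace M] [DiscreteTopology M]
      [Finite M] (ρ : DiscreteGaloisModule K M), GaloisRep.IsUnramifiedOutside S ρ →
      IsPrimaryTorsion p M → Nat.card M = n →
      Nat.card (restrictedCohomology ρ S 0) * Nat.card (restrictedCohomology ρ S 2) * Nat.card M ^ e =
        Nat.card (restrictedCohomology ρ S 1) from key _ M ρ hur hM rfl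
  intro n
  induction n using Nat.strong_induction_on with
  | _ n ih =>
    intro M _ _ _ _ ρ hur hM hn
    by_cases hall : ∀ m : M, (p : ℤ) • m = 0
    · exact hkill M ρ hur hall
    · -- an element NOT killed by `p`, and (Cauchy) an element of order `p`
      obtain ⟨m, hm⟩ := not_forall.1 hall
      have hm0 : m ≠ 0 := fun h => hm (by rw [h, smul_zero])
      haveI : Nontrivial M := ⟨⟨m, 0, hm0⟩⟩
      letI := Fintype.ofFinite M
      obtain ⟨k, hk⟩ := exists_card_eq_prime_pow M hM
      have hk0 : k ≠ 0 := by
        intro h0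
        rw [h0, pow_zero] at hk
        exact (Finite.one_lt_card_iff_nontrivial.2 (inferInstance : Nontrivial M)).ne' hk
      have hpd : p ∣ Fintype.card M := by
        rw [← Nat.card_eq_fintype_card, hk]
        exact dvd_pow_self p hk0
      obtain ⟨x, hx⟩ := exists_prime_addOrderOf_dvd_card p hpd
      have hx0 : x ≠ 0 := fun h => hp.out.one_lt.ne' (by rw [← hx, h, addOrderOf_zero])
      have hpx : (p : ℤ) • x = 0 := by
        rw [Nat.cast_smul_eq_nsmul, ← hx]
        exact addOrderOf_nsmul_eq_zero x
      -- the `Γ_K`-stable submodule `W = M[p]`, with `0 < W < M`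
      let W : Submodule ℤ M := Submodule.torsionBy ℤ M (p : ℤ)
      have hW : ∀ g, W ≤ W.comap (ρ g) := fun g => by
        intro y hy
        rw [Submodule.mem_comap, Submodule.mem_torsionBy_iff, ← map_smul,
          (Submodule.mem_torsionBy_iff _ _).1 hy, map_zero]
      have hSES := isSES_subtype_mkQ ρ W hW
      have hWp : IsPrimaryTorsion p W := fun w => ⟨1, Subtype.ext (by
        rw [pow_one, AddSubmonoidClass.coe_nsmul, ZeroMemClass.coe_zero, ← Nat.cast_smul_eq_nsmul ℤ]
        exact (Submodule.mem_torsionBy_iff _ _).1 w.2)⟩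
      have hxW : x ∈ W := (Submodule.mem_torsionBy_iff _ _).2 hpx
      have hW1 : 1 < Nat.card W := by
        rw [Finite.one_lt_card_iff_nontrivial]
        exact ⟨⟨⟨x, hxW⟩, 0, fun h => hx0 (congrArg Subtype.val h)⟩⟩
      haveI : Finite (M ⧸ W) := Finite.of_surjective _ (Submodule.Quotient.mk_surjective W)
      have hQ1 : 1 < Nat.card (M ⧸ W) := by
        rw [Finite.one_lt_card_iff_nontrivial]
        refine ⟨⟨Submodule.Quotient.mk m, 0, fun h => hm ?_⟩⟩
        exact (Submodule.mem_torsionBy_iff _ _).1 ((Submodule.Quotient.mk_eq_zero W).1 h)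
      have hmul : Nat.card M = Nat.card (M ⧸ W) * Nat.card W :=
        AddSubgroup.card_eq_card_quotient_mul_card_addSubgroup W.toAddSubgroup
      have hltQ : Nat.card (M ⧸ W) < n := by
        rw [← hn, hmul]
        exact (Nat.lt_mul_iff_one_lt_right Nat.card_pos).2 hW1
      have hltW : Nat.card W < n := by
        rw [← hn, hmul]
        exact (Nat.lt_mul_iff_one_lt_left Nat.card_pos).2 hQ1
      -- both ends satisfy the identity by induction
      have h₁ := ih _ hltW W (ContinuousRep.subrepresentation ρ W hW)
        (isUnramifiedOutside_X₁ hSES S hur) hWp rfl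
      have h₃ := ih _ hltQ (M ⧸ W) (ContinuousRep.quotient ρ W hW)
        (isUnramifiedOutside_X₃ hSES S hur) (hM.quotient W) rfl
      exact restrictedCohomology_euler_X₂ hSfin p hSp hSES hur hWp e h₁ h₃

/-- **`EPC_TC_p K p` follows from its restriction to modules killed by `p`** — the `∀`-packaged
form, in the token shape of the lane's per-prime statement (`e = nrComplexPlaces K`): for `K`
totally complex and a prime `p`, if for every finite `S ⊇ S_p` and every finite discrete
`Γ_K`-module `M` unramified outside `S` with `(p : ℤ) • M = 0` the identity
`#H⁰(G_S, M)·#H²(G_S, M)·#M^{r₂(K)} = #H¹(G_S, M)` holds, then it holds for every finite discrete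
`p`-primary such `M`. [cite: MilneADT2006, I §5, proof of Thm. 5.1 (p. 69)] -/
theorem eulerTC_of_eulerTC_killedBy (p : ℕ) [Fact p.Prime]
    (hkill : ∀ (S : Set (HeightOneSpectrum (𝓞 K))), S.Finite → ∀ (M : Type) [AddCommGroup M]
      [TopologicalSpace M] [DiscreteTopology M] [Finite M] (ρ : DiscreteGaloisModule K M),
      GaloisRep.IsUnramifiedOutside S ρ →
      (∀ v : HeightOneSpectrum (𝓞 K), ((p : ℕ) : 𝓞 K) ∈ v.asIdeal → v ∈ S) →
      (∀ m : M, (p : ℤ) • m = 0) →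
      Nat.card (restrictedCohomology ρ S 0) * Nat.card (restrictedCohomology ρ S 2) *
          Nat.card M ^ InfinitePlace.nrComplexPlaces K =
        Nat.card (restrictedCohomology ρ S 1)) :
    ∀ (S : Set (HeightOneSpectrum (𝓞 K))), S.Finite → ∀ (M : Type) [AddCommGroup M]
      [TopologicalSpace M] [DiscreteTopology M] [Finite M] (ρ : DiscreteGaloisModule K M),
      GaloisRep.IsUnramifiedOutside S ρ →
      (∀ v : HeightOneSpectrum (𝓞 K), ((p : ℕ) : 𝓞 K) ∈ v.asIdeal → v ∈ S) →
      IsPrimaryTorsion p M →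
      Nat.card (restrictedCohomology ρ S 0) * Nat.card (restrictedCohomology ρ S 2) *
          Nat.card M ^ InfinitePlace.nrComplexPlaces K =
        Nat.card (restrictedCohomology ρ S 1) :=
  fun S hS M _ _ _ _ ρ hur hSp hM =>
    restrictedCohomology_euler_of_forall_killedBy hS p hSp (InfinitePlace.nrComplexPlaces K)
      (fun B _ _ _ _ σ hσ hB => hkill S hS B σ hσ hSp hB) M ρ hur hM

end Literature.NumberTheory.GaloisCohomology

end
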